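import Summits.CriticalPhenomena.PercolationContinuityZ3.Theorems.Transplant.FKConnectivityAllQAntipodalRootFormGen
import Summits.CriticalPhenomena.PercolationContinuityZ3.Theorems.Transplant.FKConnectivityAllQAntipodalRootFormTransfer

/-!
# Connectivity correlation inequalities for `φ_{w,q}`, every `q > 0` — ROOT-FORM CALCULUS FOR ANY NUMBER OF SPECIALS, file 61γ:
# transfer of the five facts along a monotone reindexing with a constant level shift (port of file 61q to `Gen.EDat ι`)

Support file (`--supports stmt-CriticalPhenomena-4575`), FK sub-lane `prim-bschramm-fk-2` (gen 29); builds on p205010 (kernel theorem,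
internal audit signed; external expert review pending).  Standard axioms, no sorries.  The pattern-wise hypothesis is
`hd : ∀ p P, (E' (φ p)).d P = ⟨((E p).d P).lam + κ, ((E p).d P).k1, ((E p).d P).k2⟩`. [folklore]
-/

noncomputable section

namespace Summit.CriticalPhenomena.PercolationContinuityZ3.Theorems

namespace FK

namespace RootForm

namespace Gen

open Finset

variable {ι : Type*} [Fintype ι] [DecidableEq ι]

section Shift

/-- A constant level shift `κ` of all pattern data moves the level argument of all six integrands by `−κ`. [folklore] -/
theorem gintegrands_of_addLam (e e' : EDat ι) (κ : ℤ) (hd : ∀ P, e'.d P = ⟨(e.d P).lam + κ, (e.d P).k1, (e.d P).k2⟩) (J : ℤ) :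
    e'.gslot1 J = e.gslot1 (J - κ) ∧ e'.gslot0 J = e.gslot0 (J - κ) ∧ e'.gandDel J = e.gandDel (J - κ) ∧ e'.gandCon J = e.gandCon (J - κ) ∧
      e'.gandE1 J = e.gandE1 (J - κ) ∧ e'.gandE2 J = e.gandE2 (J - κ) := by
  have a1 : ∀ d : PDat, PDat.a1 ⟨d.lam + κ, d.k1, d.k2⟩ J = d.a1 (J - κ) := fun d => ind_congr (by simp only; omega)
  have a2 : ∀ d : PDat, PDat.a2 ⟨d.lam + κ, d.k1, d.k2⟩ J = d.a2 (J - κ) := fun d => ind_congr (by simp only; omega)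
  have ad : ∀ d : PDat, PDat.adel ⟨d.lam + κ, d.k1, d.k2⟩ J = d.adel (J - κ) := fun d => ind_congr (by simp only; omega)
  have ac : ∀ d : PDat, PDat.acon ⟨d.lam + κ, d.k1, d.k2⟩ J = d.acon (J - κ) := fun d => ind_congr (by simp only; omega)
  have r1 : ∀ d : PDat, PDat.r1 ⟨d.lam + κ, d.k1, d.k2⟩ J = d.r1 (J - κ) := fun d =>
    ind_congr (by simp only; constructor <;> rintro ⟨h, h'⟩ <;> exact ⟨by omega, h'⟩)
  have r2 : ∀ d : PDat, PDat.r2 ⟨d.lam + κ, d.k1, d.k2⟩ J = d.r2 (J - κ) := fun d =>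
    ind_congr (by simp only; constructor <;> rintro ⟨h, h'⟩ <;> exact ⟨by omega, h'⟩)
  simp only [EDat.gslot1, EDat.gslot0, EDat.gandDel, EDat.gandCon, EDat.gandE1, EDat.gandE2, hd, a1, a2, ad, ac, r1, r2, and_self]

end Shift

section Transfer

variable {C C' : Type*} [Fintype C] [Fintype C'] [Preorder C] [Preorder C'] {E : Env ι C} {E' : Env ι C'} {φ : C ≃ C'} {κ : ℤ}

/-- **Fact 1 transfers.** [folklore] -/
theorem gtransfer_Mt (hφ : Monotone φ)
    (hs : ∀ p J, (E' (φ p)).gslot1 J = (E p).gslot1 (J - κ) ∧ (E' (φ p)).gslot0 J = (E p).gslot0 (J - κ))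
    (hM : ∀ h0 h1 : C → ℝ, Monotone h0 → Monotone h1 → (∀ γ, 0 ≤ h0 γ) → (∀ γ, h0 γ ≤ h1 γ) → ∀ J : ℤ, 0 ≤ gMt E h0 h1 J)
    (H0 H1 : C' → ℝ) (m0 : Monotone H0) (m1 : Monotone H1) (n0 : ∀ γ, 0 ≤ H0 γ) (le : ∀ γ, H0 γ ≤ H1 γ) (J : ℤ) :
    0 ≤ gMt E' H0 H1 J := by
  have key := hM (H0 ∘ φ) (H1 ∘ φ) (m0.comp hφ) (m1.comp hφ) (fun γ => n0 _) (fun γ => le _) (J - κ)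
  unfold gMt at key ⊢
  rw [← Equiv.sum_comp φ]
  refine key.trans_eq (Finset.sum_congr rfl fun p _ => ?_)
  obtain ⟨h1, h0⟩ := hs p J
  simp only [Function.comp_apply, h1, h0]

omit [Fintype C] [Fintype C'] [Preorder C] [Preorder C'] in
/-- The parallel transform of a transferred environment is the transfer of the parallel transform. [folklore] -/
theorem gtransfer_parE_hs (hd : ∀ p P, (E' (φ p)).d P = ⟨((E p).d P).lam + κ, ((E p).d P).k1, ((E p).d P).k2⟩) (q : Bool × C) (J : ℤ) :
    (parE E' ((Equiv.prodCongr (Equiv.refl Bool) φ) q)).gslot1 J = (parE E q).gslot1 (J - κ) ∧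
      (parE E' ((Equiv.prodCongr (Equiv.refl Bool) φ) q)).gslot0 J = (parE E q).gslot0 (J - κ) := by
  obtain ⟨b, p⟩ := q
  have h := gintegrands_of_addLam (parE E (b, p)) (parE E' (b, φ p)) κ
    (fun P => by simp only [parE, EDat.par_d, hd, par_addLam]) J
  exact ⟨h.1, h.2.1⟩

omit [Fintype C] [Fintype C'] [Preorder C] [Preorder C'] in
/-- All six integrands of a transferred environment. [folklore] -/
theorem gtransfer_hs (hd : ∀ p P, (E' (φ p)).d P = ⟨((E p).d P).lam + κ, ((E p).d P).k1, ((E p).d P).k2⟩) (p : C) (J : ℤ) :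
    (E' (φ p)).gslot1 J = (E p).gslot1 (J - κ) ∧ (E' (φ p)).gslot0 J = (E p).gslot0 (J - κ) ∧ (E' (φ p)).gandDel J = (E p).gandDel (J - κ) ∧
      (E' (φ p)).gandCon J = (E p).gandCon (J - κ) ∧ (E' (φ p)).gandE1 J = (E p).gandE1 (J - κ) ∧ (E' (φ p)).gandE2 J = (E p).gandE2 (J - κ) :=
  gintegrands_of_addLam (E p) (E' (φ p)) κ (hd p) J

/-- **Fact 2 transfers.** [folklore] -/
theorem gtransfer_parE (hφ : Monotone φ)
    (hd : ∀ p P, (E' (φ p)).d P = ⟨((E p).d P).lam + κ, ((E p).d P).k1, ((E p).d P).k2⟩)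
    (hP : ∀ h0 h1 : Bool × C → ℝ, Monotone h0 → Monotone h1 → (∀ p, 0 ≤ h0 p) → (∀ p, h0 p ≤ h1 p) → ∀ J : ℤ, 0 ≤ gMt (parE E) h0 h1 J)
    (H0 H1 : Bool × C' → ℝ) (m0 : Monotone H0) (m1 : Monotone H1) (n0 : ∀ q, 0 ≤ H0 q) (le : ∀ q, H0 q ≤ H1 q) (J : ℤ) :
    0 ≤ gMt (parE E') H0 H1 J :=
  gtransfer_Mt (E := parE E) (E' := parE E') (φ := Equiv.prodCongr (Equiv.refl Bool) φ) (κ := κ) (mono_prodCongr hφ)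
    (fun q J => gtransfer_parE_hs hd q J) hP H0 H1 m0 m1 n0 le J

/-- **Fact 5 transfers** (nested free AND). [folklore] -/
theorem gtransfer_andFree (hφ : Monotone φ)
    (hs : ∀ p J, (E' (φ p)).gandE1 J = (E p).gandE1 (J - κ) ∧ (E' (φ p)).gandE2 J = (E p).gandE2 (J - κ))
    (hf : ∀ h0 h1 : C → ℝ, Monotone h0 → Monotone h1 → (∀ γ, 0 ≤ h0 γ) → (∀ γ, h0 γ ≤ h1 γ) → ∀ J : ℤ,
      0 ≤ ∑ γ, (h1 γ * (E γ).gandE1 J + h0 γ * (E γ).gandE2 J))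
    (H0 H1 : C' → ℝ) (m0 : Monotone H0) (m1 : Monotone H1) (n0 : ∀ γ, 0 ≤ H0 γ) (le : ∀ γ, H0 γ ≤ H1 γ) (J : ℤ) :
    0 ≤ ∑ γ, (H1 γ * (E' γ).gandE1 J + H0 γ * (E' γ).gandE2 J) := by
  have key := hf (H0 ∘ φ) (H1 ∘ φ) (m0.comp hφ) (m1.comp hφ) (fun γ => n0 _) (fun γ => le _) (J - κ)
  rw [← Equiv.sum_comp φ]
  refine key.trans_eq (Finset.sum_congr rfl fun p _ => ?_)
  obtain ⟨h1, h0⟩ := hs p J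
  simp only [Function.comp_apply, h1, h0]

/-- **All five facts transfer** along a monotone reindexing with a constant level shift. [folklore] -/
theorem gtransfer_facts (hφ : Monotone φ)
    (hd : ∀ p P, (E' (φ p)).d P = ⟨((E p).d P).lam + κ, ((E p).d P).k1, ((E p).d P).k2⟩)
    (h5 : (∀ h0 h1 : C → ℝ, Monotone h0 → Monotone h1 → (∀ γ, 0 ≤ h0 γ) → (∀ γ, h0 γ ≤ h1 γ) → ∀ J : ℤ, 0 ≤ gMt E h0 h1 J)
      ∧ (∀ h0 h1 : Bool × C → ℝ, Monotone h0 → Monotone h1 → (∀ p, 0 ≤ h0 p) → (∀ p, h0 p ≤ h1 p) → ∀ J : ℤ, 0 ≤ gMt (parE E) h0 h1 J)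
      ∧ (∀ h : C → ℝ, Monotone h → (∀ γ, 0 ≤ h γ) → ∀ J : ℤ, 0 ≤ ∑ γ, h γ * (E γ).gandDel J)
      ∧ (∀ h : C → ℝ, Monotone h → (∀ γ, 0 ≤ h γ) → ∀ J : ℤ, 0 ≤ ∑ γ, h γ * (E γ).gandCon J)
      ∧ (∀ h0 h1 : C → ℝ, Monotone h0 → Monotone h1 → (∀ γ, 0 ≤ h0 γ) → (∀ γ, h0 γ ≤ h1 γ) → ∀ J : ℤ,
          0 ≤ ∑ γ, (h1 γ * (E γ).gandE1 J + h0 γ * (E γ).gandE2 J))) :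
    (∀ h0 h1 : C' → ℝ, Monotone h0 → Monotone h1 → (∀ γ, 0 ≤ h0 γ) → (∀ γ, h0 γ ≤ h1 γ) → ∀ J : ℤ, 0 ≤ gMt E' h0 h1 J)
      ∧ (∀ h0 h1 : Bool × C' → ℝ, Monotone h0 → Monotone h1 → (∀ p, 0 ≤ h0 p) → (∀ p, h0 p ≤ h1 p) → ∀ J : ℤ, 0 ≤ gMt (parE E') h0 h1 J)
      ∧ (∀ h : C' → ℝ, Monotone h → (∀ γ, 0 ≤ h γ) → ∀ J : ℤ, 0 ≤ ∑ γ, h γ * (E' γ).gandDel J)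
      ∧ (∀ h : C' → ℝ, Monotone h → (∀ γ, 0 ≤ h γ) → ∀ J : ℤ, 0 ≤ ∑ γ, h γ * (E' γ).gandCon J)
      ∧ (∀ h0 h1 : C' → ℝ, Monotone h0 → Monotone h1 → (∀ γ, 0 ≤ h0 γ) → (∀ γ, h0 γ ≤ h1 γ) → ∀ J : ℤ,
          0 ≤ ∑ γ, (h1 γ * (E' γ).gandE1 J + h0 γ * (E' γ).gandE2 J)) := by
  obtain ⟨f1, f2, f3, f4, f5⟩ := h5
  refine ⟨?_, ?_, ?_, ?_, ?_⟩
  · exact fun H0 H1 m0 m1 n0 le J => gtransfer_Mt hφ (fun p J => ⟨(gtransfer_hs hd p J).1, (gtransfer_hs hd p J).2.1⟩) f1 H0 H1 m0 m1 n0 le J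
  · exact fun H0 H1 m0 m1 n0 le J => gtransfer_parE hφ hd f2 H0 H1 m0 m1 n0 le J
  · intro H mH nH J
    rw [← Equiv.sum_comp φ]
    refine (f3 (H ∘ φ) (mH.comp hφ) (fun γ => nH _) (J - κ)).trans_eq (Finset.sum_congr rfl fun p _ => ?_)
    simp only [Function.comp_apply, (gtransfer_hs hd p J).2.2.1]
  · intro H mH nH J
    rw [← Equiv.sum_comp φ]
    refine (f4 (H ∘ φ) (mH.comp hφ) (fun γ => nH _) (J - κ)).trans_eq (Finset.sum_congr rfl fun p _ => ?_)
    simp only [Function.comp_apply, (gtransfer_hs hd p J).2.2.2.1]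
  · exact fun H0 H1 m0 m1 n0 le J =>
      gtransfer_andFree hφ (fun p J => ⟨(gtransfer_hs hd p J).2.2.2.2.1, (gtransfer_hs hd p J).2.2.2.2.2⟩) f5 H0 H1 m0 m1 n0 le J

end Transfer

end Gen

end RootForm

end FK

end Summit.CriticalPhenomena.PercolationContinuityZ3.Theorems

end
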